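import Summits.ResolutionOfSingularities.ResolutionOfSingularities.Theorems.MarkedTransferCampaignW46MohWindowShadeTerminationStatement
import Summits.ResolutionOfSingularities.ResolutionOfSingularities.Theorems.MarkedTransferCampaignW46MohWindowShadeCycle
import Summits.ResolutionOfSingularities.ResolutionOfSingularities.Theorems.MarkedTransferCampaignW46MohWindowShadeFixedPoint
import HarnessLib

/-!
# [OURS · L1 W4.6] Rung (iii) "Moh window", surfaces — the in-window CYCLES ARE `p`-FOLD CURVES ON THE NOSE
  (the necessity witnesses lie exactly in the excluded class; proofs only)

Cell `res-hironaka`, rung L, slot W4.6, seat `res-L1-s46-pv-6` (gen 3).  The termination theorem (`…Termination`,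
`…FormalBranch`) excludes the formal `p`-fold-curve case, and gen 2's infinite in-window walks (`…Cycle`: the two-cycle
`F_c = u^p y + c y^{p+1} + u^p y^{p+1}`, every `p`; `…FixedPoint`: `u²y + y³ + u²y³`, `p = 2`) show an exclusion is
necessary.  Here the circle is closed in the kernel: those residual polynomials ARE `p`-th powers of smooth curves
times a cofactor, as polynomials, on the nose:

* `cycF_eq_X_mul_pow` — `F_{a^p} = y · (u + a·y + u·y)^p` for every `a` (Frobenius); in particular
  `F_{±1} = y · (u ± y + uy)^p` (`cycF_one_eq`, `cycF_neg_one_eq`);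
* `fixedF_eq_X_mul_sq` — `u²y + y³ + u²y³ = y · (u + y + uy)²` in characteristic `2`;
* `formalCurveCase_cycF` / `formalCurveCase_fixedF` — hence these states are in `CampaignW46MohWindowShadeFormalCurveCase`
  to EVERY order (`h = u + a y + uy`: `h(0) = 0`, `∂h/∂u(0) = 1`).
OURS; NOT a statement of the manuscript [claim: Hironaka2017, status: under-review], nothing of which is used.  AI review
is weaker than expert review.
-/

noncomputable section

set_option linter.dupNamespace false -- mandated namespace of this single-conjunct summit

open MvPolynomial Finset

namespace Summit.ResolutionOfSingularities.ResolutionOfSingularities.Theorems.CampaignW46.MohWindowShadeCycleCurve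

open Literature.AlgebraicGeometry.Resolution
open Literature.AlgebraicGeometry.Resolution.Hauser2010

variable (K : Type*) [Field K] (p : ℕ) [hp : Fact p.Prime] [CharP K p]

/-- **[OURS · L1 W4.6] The two-cycle polynomials are `y·h^p` on the nose:** `F_{a^p} = y·(u + a·y + u·y)^p`.
NOT a statement of the manuscript. [folklore] -/
theorem cycF_eq_X_mul_pow (a : K) :
    MohWindowShadeCycle.cycF K p (a ^ p) = X 1 * (X 0 + C a * X 1 + X 0 * X 1) ^ p := by
  unfold MohWindowShadeCycle.cycF
  rw [add_pow_char, add_pow_char, mul_pow, mul_pow, ← map_pow]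
  ring

/-- `F_1 = y·(u + y + uy)^p`. [folklore] -/
theorem cycF_one_eq : MohWindowShadeCycle.cycF K p 1 = X 1 * (X 0 + X 1 + X 0 * X 1) ^ p := by
  have h := cycF_eq_X_mul_pow K p 1
  rwa [one_pow, map_one, one_mul] at h

/-- `F_{−1} = y·(u − y + uy)^p`. [folklore] -/
theorem cycF_neg_one_eq : MohWindowShadeCycle.cycF K p (-1) = X 1 * (X 0 - X 1 + X 0 * X 1) ^ p := by
  have h := cycF_eq_X_mul_pow K p (-1)
  rw [neg_one_pow_char K p, map_neg, map_one, neg_one_mul, ← sub_eq_add_neg] at h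
  exact h

omit hp [CharP K p] in
/-- **[OURS · L1 W4.6] The fixed-point polynomial is `y·h²` on the nose** (characteristic `2`):
`u²y + y³ + u²y³ = y·(u + y + uy)²`.  NOT a statement of the manuscript. [folklore] -/
theorem fixedF_eq_X_mul_sq [CharP K 2] :
    MohWindowShadeFixedPoint.fixedF K = X 1 * (X 0 + X 1 + X 0 * X 1) ^ 2 := by
  haveI : Fact (Nat.Prime 2) := ⟨Nat.prime_two⟩
  unfold MohWindowShadeFixedPoint.fixedF
  rw [add_pow_char, add_pow_char, mul_pow]
  ring

/-- **[OURS · L1 W4.6] The two-cycle states are in the formal `p`-fold-curve case to every order** (with the SMOOTH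
factor `h = u + a y + uy`: `h(0) = 0`, `∂h/∂u(0) = 1`): the exclusion in `CampaignW46MohWindowShadeSurfaceTerminates` is
met by exactly these necessity witnesses.  NOT a statement of the manuscript. [folklore] -/
theorem formalCurveCase_cycF (a : K) (m : ℕ) :
    CampaignW46MohWindowShadeFormalCurveCase p m (MohWindowShadeCycle.cycF K p (a ^ p)) := by
  classical
  refine ⟨X 0 + C a * X 1 + X 0 * X 1, X 1, ?_, ⟨0, ?_⟩, ?_⟩
  · simp [coeff_X, coeff_X_mul']
  · rw [coeff_add, coeff_add, coeff_C_mul, coeff_X, coeff_X, coeff_X_mul', if_pos rfl, if_neg, if_pos]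
    · simp
    · simp
    · intro h
      have := DFunLike.congr_fun h 0
      simp at this
  · rw [cycF_eq_X_mul_pow, mul_comm (X 1), sub_self]
    unfold ordZero
    simp

omit hp [CharP K p] in
/-- **[OURS · L1 W4.6] The fixed-point state is in the formal `2`-fold-curve case to every order** (characteristic `2`).
NOT a statement of the manuscript. [folklore] -/
theorem formalCurveCase_fixedF [CharP K 2] (m : ℕ) :
    CampaignW46MohWindowShadeFormalCurveCase 2 m (MohWindowShadeFixedPoint.fixedF K) := by
  classical
  refine ⟨X 0 + X 1 + X 0 * X 1, X 1, ?_, ⟨0, ?_⟩, ?_⟩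
  · simp [coeff_X, coeff_X_mul']
  · rw [coeff_add, coeff_add, coeff_X, coeff_X, coeff_X_mul', if_pos rfl, if_neg, if_pos]
    · simp
    · simp
    · intro h
      have := DFunLike.congr_fun h 0
      simp at this
  · rw [fixedF_eq_X_mul_sq, mul_comm (X 1), sub_self]
    unfold ordZero
    simp

end Summit.ResolutionOfSingularities.ResolutionOfSingularities.Theorems.CampaignW46.MohWindowShadeCycleCurve
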